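import Literature.NumberTheory.Sieve.JurkatRichertLinearSieveProofs
import Literature.NumberTheory.Sieve.PolynomialValuesSieveSequence
import Literature.NumberTheory.Sieve.IwaniecAlmostPrimesMertens
import Literature.NumberTheory.Sieve.IwaniecAlmostPrimesProp1Corollary
import Literature.NumberTheory.Sieve.BatemanHornMertensProduct
import Literature.NumberTheory.Sieve.ParityBatemanHornProofs

/-!
# The classical upper-bound sieve wall for `n² + 1`, as a kernel theorem

Solo unit `solo-Parity-informed` (ideation tier, informed mode), session 10; `PLAN.md` §18, CLAIMS C45.

Notation (informal): `π_E(N) = #{n ≤ N : n²+1 prime}`, `ψ(N) = ∑_{n ≤ N} Λ(n²+1)`,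
`𝔖 = hardyLittlewoodEConst`, `ρ(d) = #{ν mod d : ν² ≡ -1}`, and for `0 < ε < 1`
`T(N) = ∑_{n ≤ N} ∑_{d ∣ n²+1, d > ⌊N^{1-ε}⌋} μ(d) log d` (the one sum on which, by
`SoloInformedLargeDivisorTiers`, every tier of Landau's problem is a one-sided bound; Conjecture E is
`T = o(N)`, the trivial bound is `T ≤ (𝔖 + o(1)) N`).

This file proves the OTHER classical wall, unconditionally and from the tree's PROVED linear sieve:

* `eventually_nSqAddOnePrimeCount_le` — `π_E(N) ≤ (2𝔖 + δ) · N / log N` for every `δ > 0` and all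
  large `N`: four times the Hardy–Littlewood prediction `𝔖 N /(2 log N)`. This is the Jurkat–Richert
  upper bound (`LinearSieve.jurkatRichert_upper_allLevels_holds`, `F(1) = 2e^γ`) for the sequence
  `{n² + 1 : n ≤ N}` (`polyAPSeq`), sifted by the primes `< N^c` (`c < 1`), with the all-levels Mertens
  hypothesis supplied by `Iwaniec1978.rho_sieveConditionOne`, the remainders by `|R_d| ≤ ρ(d)` and
  `∑_{d ≤ y} ρ(d) ≪ y`, and the main term evaluated by the Bateman–Horn Mertens product
  `log z · ∏_{p < z} (1 - ρ(p)/p) → 𝔖 e^{-γ}` (`BatemanHornMertens`). It is the `g = 2` case of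
  Halberstam–Richert, *Sieve Methods*, Thm 5.3 (constant `2 ∏_p (1 - (ρ(p)-1)/(p-1)) = 2𝔖`).
* `eventually_sum_vonMangoldt_sq_add_one_le` — `ψ(N) ≤ (4𝔖 + δ) N` eventually.
* `eventually_neg_le_largeDivisorSum` — `-(3𝔖 + δ) N ≤ T(N)` eventually, for every `0 < ε < 1`.

So the unconditional window for `T` is `[-(3𝔖 + o(1)) N, (𝔖 + o(1)) N]`: it is NOT symmetric about
`0`. The level of distribution available for `n² + 1` is `N^{1-ε} = X^{1/2-ε/2}` in terms of the size
`X = N²` of the members, where the linear sieve loses the factor `F(1)·2 = 4`, not the factor `2` of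
Bombieri's asymptotic sieve (which would need signed level `X^{1-ε} = N^{2-2ε}`). Conjecture E pins
`T = o(N)`; Landau's conjecture follows from `T ≤ (𝔖 - c) N` infinitely often
(`landauConjecture_of_frequently_largeDivisorSum_le`); nothing in between is known.

References: W. B. Jurkat, H.-E. Richert, Acta Arith. 11 (1965) 217–240; H. Halberstam, H.-E. Richert,
*Sieve Methods* (Academic Press 1974) Thm 5.3, Thm 8.4; H. Iwaniec, Invent. Math. 47 (1978) 171–188
[IwaniecInventiones1978]; M. B. Nathanson, *Additive Number Theory: The Classical Bases* (Springer 1996)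
Thms 9.7–9.8 [Nathanson1996]; P. T. Bateman, R. A. Horn, Math. Comp. 16 (1962) 363–367 [BatemanHorn1962].
-/

namespace Summit.Parity.BatemanHorn.Theorems

open Finset Filter ArithmeticFunction Asymptotics Polynomial
open scoped ArithmeticFunction.Moebius Topology
open Literature.NumberTheory.Sieve (hardyLittlewoodEConst hardyLittlewoodEConst_pos
  nSqAddOnePrimeCount polyRootCountMod isBatemanHornSystem_X_sq_add_one primesProdBelow
  squarefree_primesProdBelow primeFactors_primesProdBelow dvd_primesProdBelow_iff polyAPSeq
  polyAPSeq_sifted polyAPSeq_size polyAPSeq_density polyAPSeq_densityProduct rootDensity_apply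
  rootDensity_nonneg abs_remainder_polyAPSeq_le apIndex mem_apIndex sum_filter_polyAPSeq_a_eq_card
  SieveSequence)
open Literature.NumberTheory.Sieve.Iwaniec1978 (rho rem rho_eq_polyRootCountMod
  rho_sieveConditionOne exists_sum_rho_le)
open Literature.NumberTheory.Sieve.BatemanHornMertens (tendsto_log_mul_prod_one_sub_rootCount_single
  tendsto_log_pow_mul_comp tendsto_ceil_rpow_sub_one_atTop tendsto_log_ceil_rpow_sub_one_div_log
  rootCount_single_lt)

/-! ### The all-levels Mertens hypothesis for `ρ` -/

/-- **Hypothesis (9.34) at all levels for `{n² + 1}`.** For every `ε > 0` there is `u₁ = u₁(ε) ≥ 2`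
such that, exempting the primes `< u₁`, `∏_{u ≤ p < w, p ≥ u₁} (1 - ρ(p)/p)⁻¹ < (1 + ε) log w / log u`
for all `1 < u < w ≤ z` — from the proved sieve condition
`∏_{w ≤ p < z} (1 - ρ(p)/p)⁻¹ ≤ (log z/log w)(1 + K/log w)` (`Iwaniec1978.rho_sieveConditionOne`)
with `K/log u₁ ≤ ε/2`. -/
theorem exists_hasMertensHypothesisBelow_sqAddOne {ε : ℝ} (hε : 0 < ε) :
    ∃ u₁ : ℝ, 2 ≤ u₁ ∧ ∀ (N : ℕ) (z : ℝ),
      (polyAPSeq (X ^ 2 + 1 : ℤ[X]) N 1 0).HasMertensHypothesisBelow (primesProdBelow z)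
        ((Nat.primesBelow ⌈z⌉₊).filter fun p : ℕ => (p : ℝ) < u₁) ε z := by
  obtain ⟨K, hK1, hK⟩ := rho_sieveConditionOne
  refine ⟨max 2 (Real.exp (2 * K / ε)), le_max_left _ _, fun N z => ?_⟩
  set u₁ := max 2 (Real.exp (2 * K / ε)) with hu₁
  have hu₁2 : 2 ≤ u₁ := le_max_left _ _
  have hK0 : 0 < K := by linarith
  have hlogu₁ : 2 * K / ε ≤ Real.log u₁ := by
    rw [← Real.log_exp (2 * K / ε)]
    exact Real.log_le_log (Real.exp_pos _) (le_max_right _ _)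
  have h2Kε : 0 < 2 * K / ε := by positivity
  have hlogu₁0 : 0 < Real.log u₁ := h2Kε.trans_le hlogu₁
  refine SieveSequence.hasMertensHypothesisBelow_of_le hε fun u w hu huw hwz => ?_
  have hlogu : 0 < Real.log u := Real.log_pos hu
  have hloguw : Real.log u ≤ Real.log w := Real.log_le_log (by linarith) huw.le
  have hlogw : 0 < Real.log w := hlogu.trans_le hloguw
  -- the index set is `{p prime : p < w, max u u₁ ≤ p}`
  have hset : (((primesProdBelow z).primeFactors \
      (Nat.primesBelow ⌈z⌉₊).filter fun p : ℕ => (p : ℝ) < u₁).filter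
        fun p : ℕ => u ≤ (p : ℝ) ∧ (p : ℝ) < w)
      = (Nat.primesBelow ⌈w⌉₊).filter fun p : ℕ => max u u₁ ≤ (p : ℝ) := by
    ext p
    simp only [Finset.mem_filter, Finset.mem_sdiff, primeFactors_primesProdBelow,
      Nat.mem_primesBelow, Nat.lt_ceil, max_le_iff]
    constructor
    · rintro ⟨⟨⟨hpz, hp⟩, h2⟩, hup, hpw⟩
      refine ⟨⟨hpw, hp⟩, hup, ?_⟩
      by_contra h3
      exact h2 ⟨⟨hpz, hp⟩, lt_of_not_ge h3⟩
    · rintro ⟨⟨hpw, hp⟩, hup, hu₁p⟩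
      exact ⟨⟨⟨hpw.trans_le hwz, hp⟩, fun h => absurd h.2 (not_lt.mpr hu₁p)⟩, hup, hpw⟩
  rw [hset]
  simp only [polyAPSeq_density, rootDensity_apply, ← rho_eq_polyRootCountMod]
  have hone : 1 ≤ Real.log w / Real.log u := (one_le_div hlogu).mpr hloguw
  by_cases hw' : max u u₁ < w
  · have hmax2 : 2 ≤ max u u₁ := le_max_of_le_right hu₁2
    have hlogmax : Real.log u ≤ Real.log (max u u₁) :=
      Real.log_le_log (by linarith) (le_max_left _ _)
    have hlogmax₁ : Real.log u₁ ≤ Real.log (max u u₁) :=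
      Real.log_le_log (by linarith) (le_max_right _ _)
    have hlogmax0 : 0 < Real.log (max u u₁) := hlogu.trans_le hlogmax
    refine (hK (max u u₁) w hmax2 hw').trans ?_
    have h1 : Real.log w / Real.log (max u u₁) ≤ Real.log w / Real.log u :=
      div_le_div_of_nonneg_left hlogw.le hlogu hlogmax
    have h2 : K / Real.log (max u u₁) ≤ ε / 2 :=
      calc K / Real.log (max u u₁) ≤ K / Real.log u₁ :=
            div_le_div_of_nonneg_left hK0.le hlogu₁0 hlogmax₁
        _ ≤ K / (2 * K / ε) := div_le_div_of_nonneg_left hK0.le h2Kε hlogu₁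
        _ = ε / 2 := by field_simp
    have h3 : 0 ≤ K / Real.log (max u u₁) := div_nonneg hK0.le hlogmax0.le
    calc Real.log w / Real.log (max u u₁) * (1 + K / Real.log (max u u₁))
        ≤ Real.log w / Real.log u * (1 + ε / 2) :=
          mul_le_mul h1 (by linarith) (by linarith) (div_nonneg hlogw.le hlogu.le)
      _ = (1 + ε / 2) * (Real.log w / Real.log u) := mul_comm _ _
  · rw [Finset.filter_false_of_mem, Finset.prod_empty]
    · exact one_le_mul_of_one_le_of_one_le (by linarith) hone
    · intro p hp
      have hpw : (p : ℝ) < w := Nat.lt_ceil.mp (Nat.mem_primesBelow.mp hp).1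
      exact not_le.mpr (hpw.trans_le (not_lt.mp hw'))

/-! ### The sieve bound at a fixed level `z` (`D = z`, `s = 1`) -/

/-- **The Jurkat–Richert bound for `{n² + 1 : n ≤ N}` at `s = 1`.** For `0 < ε < 1/200`, `z ≥ 2`,
the primes `< u₁` exempted as in `exists_hasMertensHypothesisBelow_sqAddOne`, and
`∑_{m ≤ y} ρ(m) ≤ C y` (`y ≥ 2`):
`π_E(N) ≤ (2e^γ + ε e^{13}) · ∏_{p < z} (1 - ρ(p)/p) · N + C · z · ∏_{p < u₁} p + z`
(sifted count `S(𝒜, P(z)) ≥ π_E(N) - z`, remainders `|R_d| ≤ ρ(d)` summed over `d < z ∏_{p<u₁} p`). -/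
theorem nSqAddOnePrimeCount_le_sieve {ε u₁ z C : ℝ} (hε : 0 < ε) (hε' : ε < 1 / 200)
    (hz : 2 ≤ z) (N : ℕ)
    (hM : (polyAPSeq (X ^ 2 + 1 : ℤ[X]) N 1 0).HasMertensHypothesisBelow (primesProdBelow z)
      ((Nat.primesBelow ⌈z⌉₊).filter fun p : ℕ => (p : ℝ) < u₁) ε z)
    (hC : ∀ y : ℝ, 2 ≤ y → ∑ m ∈ Icc 1 ⌊y⌋₊, (rho m : ℝ) ≤ C * y) :
    (nSqAddOnePrimeCount N : ℝ) ≤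
      (2 * Real.exp Real.eulerMascheroniConstant + ε * Real.exp 13) *
          ((∏ p ∈ Nat.primesBelow ⌈z⌉₊, (1 - (rho p : ℝ) / p)) * N)
        + C * (z * ((∏ p ∈ Nat.primesBelow ⌈u₁⌉₊, p : ℕ) : ℝ)) + z := by
  set f : ℤ[X] := X ^ 2 + 1 with hf
  set Q := (Nat.primesBelow ⌈z⌉₊).filter fun p : ℕ => (p : ℝ) < u₁ with hQ
  set x : ℝ := (N : ℝ) ^ 2 + 1 with hx
  have hz0 : 0 ≤ z := by linarith
  have hlogz : 0 < Real.log z := Real.log_pos (by linarith)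
  -- the values on the index set
  have heval : ∀ n : ℕ, f.eval (n : ℤ) = ((n ^ 2 + 1 : ℕ) : ℤ) := by
    intro n; simp only [hf, eval_add, eval_pow, eval_X, eval_one]; push_cast; ring
  have hIdx : apIndex N 1 0 = Icc 1 N := by
    ext n
    rw [mem_apIndex, mem_Icc]
    constructor
    · rintro ⟨⟨h1, h2⟩, -⟩; exact ⟨by omega, h2⟩
    · rintro ⟨h1, h2⟩; exact ⟨⟨by omega, h2⟩, Nat.modEq_one⟩
  have hxval : ∀ n ∈ apIndex N 1 0, 0 < f.eval (n : ℤ) ∧ ((f.eval (n : ℤ) : ℤ) : ℝ) ≤ x := by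
    intro n hn
    rw [hIdx, mem_Icc] at hn
    rw [heval]
    refine ⟨by positivity, ?_⟩
    have : (n : ℝ) ≤ N := by exact_mod_cast hn.2
    push_cast
    nlinarith
  -- hypotheses of the Jurkat–Richert theorem
  have h01 : ∀ p ∈ (primesProdBelow z).primeFactors,
      0 ≤ (polyAPSeq f N 1 0).density p ∧ (polyAPSeq f N 1 0).density p < 1 := by
    intro p hp
    have hpr : p.Prime := Nat.prime_of_mem_primeFactors hp
    rw [polyAPSeq_density, rootDensity_apply]
    refine ⟨by positivity, ?_⟩
    rw [div_lt_one (by exact_mod_cast hpr.pos)]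
    exact_mod_cast rootCount_single_lt isBatemanHornSystem_X_sq_add_one 0 hpr
  have hQsub : Q ⊆ (primesProdBelow z).primeFactors := by
    rw [primeFactors_primesProdBelow]; exact filter_subset _ _
  have hs : Real.log z / Real.log z = 1 := div_self hlogz.ne'
  have hX : (polyAPSeq f N 1 0).size x = N := by rw [polyAPSeq_size]; simp
  have hsize : (polyAPSeq f N 1 0).size x = ∑ n ∈ Ioc 0 ⌊x⌋₊, (polyAPSeq f N 1 0).a n := by
    have h := sum_filter_polyAPSeq_a_eq_card f N 1 0 hxval (fun _ => True)
    rw [Finset.filter_true, Finset.filter_true, hIdx, Nat.card_Icc, Nat.add_sub_cancel] at h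
    rw [h, hX]
  have hJR := Literature.NumberTheory.Sieve.LinearSieve.jurkatRichert_upper_allLevels_holds
    (polyAPSeq f N 1 0) x (primesProdBelow z) Q ε z z (squarefree_primesProdBelow z) dvd_rfl h01
    hQsub hε hε' hz le_rfl (by rw [hs]; norm_num) hsize hM
  rw [hs, div_one, show (14 : ℝ) - 1 = 13 by norm_num] at hJR
  -- the sifted count and `π_E`
  have hsift : (polyAPSeq f N 1 0).sifted x (primesProdBelow z) =
      #((Icc 1 N).filter fun n : ℕ => (n ^ 2 + 1).Coprime (primesProdBelow z)) := by
    rw [polyAPSeq_sifted f N 1 0 hxval, hIdx]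
    have hfc : (Icc 1 N).filter (fun n : ℕ => (f.eval (n : ℤ)).natAbs.Coprime (primesProdBelow z))
        = (Icc 1 N).filter fun n : ℕ => (n ^ 2 + 1).Coprime (primesProdBelow z) :=
      filter_congr fun n _ => by rw [heval, Int.natAbs_natCast]
    rw [hfc]
  have hπ : (nSqAddOnePrimeCount N : ℝ) ≤ (polyAPSeq f N 1 0).sifted x (primesProdBelow z) + z := by
    have hsub : (Icc 1 N).filter (fun n : ℕ => (n ^ 2 + 1).Prime) ⊆
        (Icc 1 N).filter (fun n : ℕ => (n ^ 2 + 1).Coprime (primesProdBelow z)) ∪ Icc 1 ⌊z⌋₊ := by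
      intro n hn
      rw [mem_filter] at hn
      rw [mem_union]
      by_cases hc : (n ^ 2 + 1).Coprime (primesProdBelow z)
      · exact Or.inl (mem_filter.mpr ⟨hn.1, hc⟩)
      · refine Or.inr (mem_Icc.mpr ?_)
        have hdvd : (n ^ 2 + 1) ∣ primesProdBelow z := by
          by_contra hnd
          exact hc ((Nat.Prime.coprime_iff_not_dvd hn.2).mpr hnd)
        have hlt : ((n ^ 2 + 1 : ℕ) : ℝ) < z := (dvd_primesProdBelow_iff hn.2 z).mp hdvd
        refine ⟨(mem_Icc.mp hn.1).1, Nat.le_floor ?_⟩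
        have h1 : (n : ℝ) ≤ (n : ℝ) ^ 2 + 1 := by nlinarith [sq_nonneg ((n : ℝ) - 1)]
        push_cast at hlt
        linarith
    calc (nSqAddOnePrimeCount N : ℝ)
        = #((Icc 1 N).filter fun n : ℕ => (n ^ 2 + 1).Prime) := by rfl
      _ ≤ #((Icc 1 N).filter (fun n : ℕ => (n ^ 2 + 1).Coprime (primesProdBelow z)) ∪ Icc 1 ⌊z⌋₊) := by
          exact_mod_cast card_le_card hsub
      _ ≤ #((Icc 1 N).filter fun n : ℕ => (n ^ 2 + 1).Coprime (primesProdBelow z))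
            + #(Icc 1 ⌊z⌋₊) := by
          exact_mod_cast card_union_le _ _
      _ = (polyAPSeq f N 1 0).sifted x (primesProdBelow z) + ⌊z⌋₊ := by
          rw [hsift, Nat.card_Icc, Nat.add_sub_cancel]
      _ ≤ (polyAPSeq f N 1 0).sifted x (primesProdBelow z) + z := by
          gcongr; exact Nat.floor_le hz0
  -- main term
  have hV : (polyAPSeq f N 1 0).densityProduct (primesProdBelow z) =
      ∏ p ∈ Nat.primesBelow ⌈z⌉₊, (1 - (rho p : ℝ) / p) := by
    rw [polyAPSeq_densityProduct]
    simp only [hf, rho_eq_polyRootCountMod]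
  -- remainder
  set Pu : ℕ := ∏ p ∈ Nat.primesBelow ⌈u₁⌉₊, p with hPu
  have hPupos : 0 < Pu := prod_pos fun p hp => (Nat.mem_primesBelow.mp hp).2.pos
  have hQprod : (∏ q ∈ Q, (q : ℝ)) ≤ (Pu : ℝ) := by
    have hdvd : (∏ q ∈ Q, q) ∣ Pu := prod_dvd_prod_of_subset _ _ _ fun p hp => by
      obtain ⟨hp1, hp2⟩ := mem_filter.mp hp
      exact Nat.mem_primesBelow.mpr ⟨Nat.lt_ceil.mpr hp2, (Nat.mem_primesBelow.mp hp1).2⟩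
    have hle : ((∏ q ∈ Q, q : ℕ) : ℝ) ≤ (Pu : ℝ) := by exact_mod_cast Nat.le_of_dvd hPupos hdvd
    simpa only [Nat.cast_prod] using hle
  have hR : ∑ d ∈ (primesProdBelow z).divisors.filter (fun d : ℕ => (d : ℝ) < z * ∏ q ∈ Q, (q : ℝ)),
      |(polyAPSeq f N 1 0).remainder d x| ≤ C * (z * Pu) := by
    have hsub : (primesProdBelow z).divisors.filter (fun d : ℕ => (d : ℝ) < z * ∏ q ∈ Q, (q : ℝ)) ⊆
        Icc 1 ⌊z * (Pu : ℝ)⌋₊ := by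
      intro d hd
      obtain ⟨hdP, hdlt⟩ := mem_filter.mp hd
      rw [mem_Icc]
      refine ⟨Nat.pos_of_mem_divisors hdP, Nat.le_floor ?_⟩
      exact (hdlt.trans_le (mul_le_mul_of_nonneg_left hQprod hz0)).le
    calc ∑ d ∈ (primesProdBelow z).divisors.filter (fun d : ℕ => (d : ℝ) < z * ∏ q ∈ Q, (q : ℝ)),
          |(polyAPSeq f N 1 0).remainder d x|
        ≤ ∑ d ∈ (primesProdBelow z).divisors.filter (fun d : ℕ => (d : ℝ) < z * ∏ q ∈ Q, (q : ℝ)),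
            (rho d : ℝ) := by
          refine sum_le_sum fun d hd => ?_
          have hd0 : 0 < d := Nat.pos_of_mem_divisors (mem_filter.mp hd).1
          have h := abs_remainder_polyAPSeq_le f (N := N) (q := 1) (r := 0) (m := d) one_pos hd0
            (Nat.coprime_one_left d) hxval
          simpa only [hf, ← rho_eq_polyRootCountMod] using h
      _ ≤ ∑ d ∈ Icc 1 ⌊z * (Pu : ℝ)⌋₊, (rho d : ℝ) :=
          sum_le_sum_of_subset_of_nonneg hsub fun _ _ _ => Nat.cast_nonneg _
      _ ≤ C * (z * Pu) := hC _ (by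
          have : (1 : ℝ) ≤ Pu := by exact_mod_cast hPupos
          nlinarith)
  -- assemble
  rw [hV, hX] at hJR
  linarith [hπ, hJR, hR]

/-! ### `π_E(N) ≤ (2𝔖 + δ) N / log N` -/

/-- `log N · ∏_{p < N^c} (1 - ρ(p)/p) → 𝔖 e^{-γ} / c` (`c > 0`): the Bateman–Horn Mertens product
for `X² + 1` (`BatemanHornMertens.tendsto_log_mul_prod_one_sub_rootCount_single`) at the sieving
level `z = N^c`. -/
theorem tendsto_log_mul_prod_one_sub_rho_div {c : ℝ} (hc : 0 < c) :
    Tendsto (fun N : ℕ => Real.log N *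
        ∏ p ∈ Nat.primesBelow ⌈(N : ℝ) ^ c⌉₊, (1 - (rho p : ℝ) / p)) atTop
      (𝓝 (hardyLittlewoodEConst * Real.exp (-Real.eulerMascheroniConstant) * c⁻¹)) := by
  have h : Tendsto (fun n : ℕ => Real.log n ^ 1 *
      ∏ p ∈ Nat.primesLE n, (1 - (rho p : ℝ) / p)) atTop
      (𝓝 (hardyLittlewoodEConst * Real.exp (-Real.eulerMascheroniConstant))) := by
    have h0 := tendsto_log_mul_prod_one_sub_rootCount_single isBatemanHornSystem_X_sq_add_one
    simp only [pow_one, rho_eq_polyRootCountMod]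
    exact h0
  have h2 := tendsto_log_pow_mul_comp 1 hc h (tendsto_ceil_rpow_sub_one_atTop hc)
    (tendsto_log_ceil_rpow_sub_one_div_log hc)
  simp only [pow_one] at h2
  refine h2.congr fun N => ?_
  rw [Nat.primesBelow_eq_primesLE_sub_one]

/-- **The classical upper bound for primes `n² + 1`**: for every `δ > 0`,
`π_E(N) ≤ (2𝔖 + δ) N / log N` for all large `N` — four times Conjecture E's `𝔖 N/(2 log N)`
(Halberstam–Richert Thm 5.3 for `g = 2`; here from the Jurkat–Richert bound with `F(1) = 2e^γ` at
sieving level `z = N^c`, `c → 1`, `ε → 0`). -/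
theorem eventually_nSqAddOnePrimeCount_le {δ : ℝ} (hδ : 0 < δ) :
    ∀ᶠ N : ℕ in atTop,
      (nSqAddOnePrimeCount N : ℝ) ≤ (2 * hardyLittlewoodEConst + δ) * N / Real.log N := by
  have hS := hardyLittlewoodEConst_pos
  -- parameters: level exponent `c`, sieve parameter `ε`, slack `η`
  obtain ⟨c, hcdef⟩ : ∃ c : ℝ, c = 16 * hardyLittlewoodEConst / (16 * hardyLittlewoodEConst + δ) :=
    ⟨_, rfl⟩
  have hc0 : 0 < c := by rw [hcdef]; positivity
  have hc1 : c < 1 := by rw [hcdef, div_lt_one (by positivity)]; linarith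
  have hSc : hardyLittlewoodEConst * c⁻¹ = hardyLittlewoodEConst + δ / 16 := by
    rw [hcdef, inv_div]; field_simp
  obtain ⟨ε, hεdef⟩ : ∃ ε : ℝ,
      ε = min (1 / 400) (δ / (Real.exp 13 * (16 * hardyLittlewoodEConst + δ))) := ⟨_, rfl⟩
  have hε : 0 < ε := by rw [hεdef]; exact lt_min (by norm_num) (by positivity)
  have hε' : ε < 1 / 200 := by rw [hεdef]; exact (min_le_left _ _).trans_lt (by norm_num)
  have hε13 : ε * Real.exp 13 * (hardyLittlewoodEConst + δ / 16) ≤ δ / 16 := by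
    have h1 : ε ≤ δ / (Real.exp 13 * (16 * hardyLittlewoodEConst + δ)) := by
      rw [hεdef]; exact min_le_right _ _
    calc ε * Real.exp 13 * (hardyLittlewoodEConst + δ / 16)
        ≤ δ / (Real.exp 13 * (16 * hardyLittlewoodEConst + δ)) * Real.exp 13 *
            (hardyLittlewoodEConst + δ / 16) := by gcongr
      _ = δ / 16 := by field_simp
  have hcoef0 : 0 < 2 * Real.exp Real.eulerMascheroniConstant + ε * Real.exp 13 := by positivity
  obtain ⟨η, hηdef⟩ : ∃ η : ℝ,
      η = δ / (8 * (2 * Real.exp Real.eulerMascheroniConstant + ε * Real.exp 13)) := ⟨_, rfl⟩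
  have hη : 0 < η := by rw [hηdef]; positivity
  -- the data: Mertens hypothesis, mean value of `ρ`, the Mertens product at level `N^c`
  obtain ⟨u₁, -, hMert⟩ := exists_hasMertensHypothesisBelow_sqAddOne hε
  obtain ⟨C, hC0, hC⟩ := exists_sum_rho_le
  obtain ⟨Pu, hPudef⟩ : ∃ Pu : ℕ, Pu = ∏ p ∈ Nat.primesBelow ⌈u₁⌉₊, p := ⟨_, rfl⟩
  have hPu1 : (1 : ℝ) ≤ Pu := by
    rw [hPudef]; exact_mod_cast prod_pos fun p hp => (Nat.mem_primesBelow.mp hp).2.pos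
  have hEγ : Real.exp Real.eulerMascheroniConstant * Real.exp (-Real.eulerMascheroniConstant) = 1 := by
    rw [← Real.exp_add, add_neg_cancel, Real.exp_zero]
  have hEγ1 : Real.exp (-Real.eulerMascheroniConstant) ≤ 1 := by
    rw [Real.exp_le_one_iff]
    have := Real.one_half_lt_eulerMascheroniConstant
    linarith
  have hVle : ∀ᶠ N : ℕ in atTop, Real.log N *
      ∏ p ∈ Nat.primesBelow ⌈(N : ℝ) ^ c⌉₊, (1 - (rho p : ℝ) / p) ≤
        hardyLittlewoodEConst * Real.exp (-Real.eulerMascheroniConstant) * c⁻¹ + η :=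
    (tendsto_log_mul_prod_one_sub_rho_div hc0).eventually_le_const (by linarith)
  -- the main-term constant: `(2e^γ + ε e^{13}) (𝔖 e^{-γ}/c + η) ≤ 2𝔖 + 5δ/16`
  have hcoefB : (2 * Real.exp Real.eulerMascheroniConstant + ε * Real.exp 13) *
      (hardyLittlewoodEConst * Real.exp (-Real.eulerMascheroniConstant) * c⁻¹ + η) ≤
        2 * hardyLittlewoodEConst + 5 * δ / 16 := by
    have h1 : (2 * Real.exp Real.eulerMascheroniConstant + ε * Real.exp 13) *
        (hardyLittlewoodEConst * Real.exp (-Real.eulerMascheroniConstant) * c⁻¹ + η)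
        = 2 * (hardyLittlewoodEConst * c⁻¹) *
            (Real.exp Real.eulerMascheroniConstant * Real.exp (-Real.eulerMascheroniConstant))
          + ε * Real.exp 13 * (hardyLittlewoodEConst * c⁻¹) *
            Real.exp (-Real.eulerMascheroniConstant)
          + (2 * Real.exp Real.eulerMascheroniConstant + ε * Real.exp 13) * η := by ring
    have h2 : (2 * Real.exp Real.eulerMascheroniConstant + ε * Real.exp 13) * η = δ / 8 := by
      rw [hηdef]; field_simp
    rw [h1, hEγ, hSc, h2]
    have h3 : ε * Real.exp 13 * (hardyLittlewoodEConst + δ / 16) *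
        Real.exp (-Real.eulerMascheroniConstant) ≤ δ / 16 * 1 :=
      mul_le_mul hε13 hEγ1 (Real.exp_pos _).le (by positivity)
    linarith
  -- the remainder is `o(N / log N)`: `log N ≤ a N^{1-c}` eventually, `a = δ / (2 (C ∏_{p<u₁} p + 1))`
  have hCP : 0 < C * Pu + 1 := by positivity
  obtain ⟨a, hadef⟩ : ∃ a : ℝ, a = δ / (2 * (C * Pu + 1)) := ⟨_, rfl⟩
  have ha : 0 < a := by rw [hadef]; positivity
  have haid : (C * Pu + 1) * a = δ / 2 := by rw [hadef]; field_simp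
  have hlog : ∀ᶠ N : ℕ in atTop, Real.log N ≤ a * (N : ℝ) ^ (1 - c) := by
    have h := (isLittleO_log_rpow_atTop (by linarith : (0 : ℝ) < 1 - c)).bound ha
    filter_upwards [tendsto_natCast_atTop_atTop.eventually h, eventually_ge_atTop 1] with N hN hN1
    have hN' : (1 : ℝ) ≤ N := by exact_mod_cast hN1
    rwa [Real.norm_of_nonneg (Real.log_nonneg hN'),
      Real.norm_of_nonneg (Real.rpow_nonneg (by linarith) _)] at hN
  have hz2 : ∀ᶠ N : ℕ in atTop, (2 : ℝ) ≤ (N : ℝ) ^ c :=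
    ((tendsto_rpow_atTop hc0).comp tendsto_natCast_atTop_atTop).eventually_ge_atTop 2
  filter_upwards [hVle, hlog, hz2, eventually_ge_atTop 2] with N hVN hlogN hz hN2
  have hN : (2 : ℝ) ≤ N := by exact_mod_cast hN2
  have hN0 : (0 : ℝ) < N := by linarith
  have hlog0 : 0 < Real.log N := Real.log_pos (by linarith)
  have h := nSqAddOnePrimeCount_le_sieve hε hε' hz N (hMert N _) hC
  rw [← hPudef] at h
  rw [le_div_iff₀ hlog0]
  have hsplit : (N : ℝ) ^ c * (N : ℝ) ^ (1 - c) = N := by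
    rw [← Real.rpow_add hN0, add_sub_cancel, Real.rpow_one]
  calc (nSqAddOnePrimeCount N : ℝ) * Real.log N
      ≤ ((2 * Real.exp Real.eulerMascheroniConstant + ε * Real.exp 13) *
            ((∏ p ∈ Nat.primesBelow ⌈(N : ℝ) ^ c⌉₊, (1 - (rho p : ℝ) / p)) * N)
          + C * ((N : ℝ) ^ c * Pu) + (N : ℝ) ^ c) * Real.log N :=
        mul_le_mul_of_nonneg_right h hlog0.le
    _ = (2 * Real.exp Real.eulerMascheroniConstant + ε * Real.exp 13) *
            (Real.log N * ∏ p ∈ Nat.primesBelow ⌈(N : ℝ) ^ c⌉₊, (1 - (rho p : ℝ) / p)) * N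
          + (C * Pu + 1) * ((N : ℝ) ^ c * Real.log N) := by ring
    _ ≤ (2 * Real.exp Real.eulerMascheroniConstant + ε * Real.exp 13) *
            (hardyLittlewoodEConst * Real.exp (-Real.eulerMascheroniConstant) * c⁻¹ + η) * N
          + (C * Pu + 1) * ((N : ℝ) ^ c * (a * (N : ℝ) ^ (1 - c))) := by
        gcongr
    _ = (2 * Real.exp Real.eulerMascheroniConstant + ε * Real.exp 13) *
            (hardyLittlewoodEConst * Real.exp (-Real.eulerMascheroniConstant) * c⁻¹ + η) * N
          + (C * Pu + 1) * a * N := by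
        rw [mul_left_comm ((N : ℝ) ^ c) a, hsplit]; ring
    _ ≤ (2 * hardyLittlewoodEConst + 5 * δ / 16) * N + δ / 2 * N := by
        rw [haid]; gcongr
    _ ≤ (2 * hardyLittlewoodEConst + δ) * N := by
        have : 0 ≤ δ * N := by positivity
        linarith

end Summit.Parity.BatemanHorn.Theorems
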